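import Mathlib
import Summits.ValiantsHypothesis.ValiantsHypothesis.Theorems.AlgebraicKWGamesLinearFormSearchUpper

/-!
# Calibration of the identification adversary, II: `B`-ary search with few alternations

Support theorem for the crux `stmt-ValiantsHypothesis-10298` (`…Theses.AlgebraicKWGames.KWPerLowerBound`),
filed `--supports`; the crux is NOT proved.  Continues `…AlgebraicKWGamesLinearFormSearchUpper`.

The history-dependent rung `kwSearch_lowerBound_of_altBound` says: with at most `Δ` alternations along
every zero pattern, no depth-`T` protocol solves the KW game of any polynomial depending on every cell
once `(2T+1)^(Δ+2) + 1 ≤ n²`.  This file shows what alternation buys on the other side, for the linear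
form `ℓ = Σ_e x_e` (which depends on every cell): with `2ℓ - 1` alternations and depth `2Bℓ` its KW
game is solved whenever `n² ≤ B^ℓ` (`kwSearch_linearForm_blocks`).  The protocol is `B`-ARY SEARCH: in
level `i` Alice announces, in `B` consecutive rounds, the sums of her entries over the `B` parts of the
current interval of cells; Bob answers, in `B` rounds, with the differences `Σ_{part q} (a_e - b_e)`;
the public zero bits then name a part of nonzero mass (one exists by additivity), which becomes the
interval of level `i+1`.  So for search with `Δ` alternations the truth lies between the exponents
`≈ Δ/2` (this file) and `Δ + 2` (the rung) of `n² ≶ T^{…}`: the identification adversary measures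
alternation × log(depth), nothing about the permanent.

Honest framing: toy communication model, dormant route; nothing here bears on VP versus VNP.
-/

-- the summit and the problem share the name `ValiantsHypothesis` (D-0017 single-conjunct layout)
set_option linter.dupNamespace false

namespace Summit.ValiantsHypothesis.ValiantsHypothesis.Theorems.AlgebraicKWGames

open MvPolynomial LinSearch

namespace BlockSearch

variable {n : ℕ}

open scoped Classical in
/-- The part chosen in level `i`, read off a zero pattern `z`: some `q < B` whose test bit (round
`B(2i+1) + q`, Bob's `q`-th difference) is NOT set, i.e. a part of nonzero mass; `0` if there is none. -/
noncomputable def part (B : ℕ) (z : ℕ → Bool) (i : ℕ) : ℕ :=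
  if h : ∃ q, q < B ∧ z (B * (2 * i + 1) + q) = false then Nat.find h else 0

/-- The chosen part is one of the `B` parts (when `B ≥ 1`). -/
theorem part_lt {B : ℕ} (hB : 1 ≤ B) (z : ℕ → Bool) (i : ℕ) : part B z i < B := by
  unfold part
  split_ifs with h
  · exact (Nat.find_spec h).1
  · omega

/-- If some part's test bit is unset, the chosen part's test bit is unset. -/
theorem part_spec {B : ℕ} {z : ℕ → Bool} {i : ℕ} (h : ∃ q, q < B ∧ z (B * (2 * i + 1) + q) = false) :
    z (B * (2 * i + 1) + part B z i) = false := by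
  unfold part
  rw [dif_pos h]
  exact (Nat.find_spec h).2

/-- `part` depends only on the bits of level `i`. -/
theorem part_congr (B : ℕ) {z z' : ℕ → Bool} (i : ℕ)
    (h : ∀ q < B, z (B * (2 * i + 1) + q) = z' (B * (2 * i + 1) + q)) : part B z i = part B z' i := by
  have hiff : (∃ q, q < B ∧ z (B * (2 * i + 1) + q) = false) ↔
      (∃ q, q < B ∧ z' (B * (2 * i + 1) + q) = false) := by
    constructor
    · rintro ⟨q, hq, hz⟩; exact ⟨q, hq, by rw [← h q hq]; exact hz⟩
    · rintro ⟨q, hq, hz⟩; exact ⟨q, hq, by rw [h q hq]; exact hz⟩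
  unfold part
  by_cases hc : ∃ q, q < B ∧ z (B * (2 * i + 1) + q) = false
  · have hc' := hiff.mp hc
    rw [dif_pos hc, dif_pos hc']
    apply le_antisymm
    · exact Nat.find_min' hc ⟨(Nat.find_spec hc').1, by rw [h _ (Nat.find_spec hc').1]; exact (Nat.find_spec hc').2⟩
    · exact Nat.find_min' hc' ⟨(Nat.find_spec hc).1, by rw [← h _ (Nat.find_spec hc).1]; exact (Nat.find_spec hc).2⟩
  · rw [dif_neg hc, dif_neg (fun h' => hc (hiff.mpr h'))]

/-- The left end of the interval of level `i` (width `B^(ℓ-i)`), read off a zero pattern. -/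
noncomputable def loB (B ℓ : ℕ) (z : ℕ → Bool) (i : ℕ) : ℕ :=
  ∑ j ∈ Finset.range i, part B z j * B ^ (ℓ - 1 - j)

/-- One more level. -/
theorem loB_succ (B ℓ : ℕ) (z : ℕ → Bool) (i : ℕ) :
    loB B ℓ z (i + 1) = loB B ℓ z i + part B z i * B ^ (ℓ - 1 - i) := by
  simp [loB, Finset.sum_range_succ]

/-- `loB` of level `i` depends only on the zero bits of the rounds `< 2Bi`. -/
theorem loB_congr (B ℓ : ℕ) {z z' : ℕ → Bool} {i : ℕ} (h : ∀ t < 2 * B * i, z t = z' t) :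
    loB B ℓ z i = loB B ℓ z' i := by
  unfold loB
  refine Finset.sum_congr rfl fun j hj => ?_
  have hj' : j < i := Finset.mem_range.mp hj
  rw [part_congr B j (fun q hq => h _ ?_)]
  have : B * (2 * j + 1) + q < B * (2 * j + 2) := by nlinarith
  calc B * (2 * j + 1) + q < B * (2 * j + 2) := this
    _ ≤ 2 * B * i := by nlinarith

/-- All cells lie in `[0, W)` when `n² ≤ W`. -/
theorem cellsIn_zero_eq_univ_of_le {W : ℕ} (hW : n * n ≤ W) :
    (cellsIn 0 W : Finset (Fin n × Fin n)) = Finset.univ := by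
  ext e
  simp only [cellsIn, Finset.mem_filter, Finset.mem_univ, true_and, zero_le, zero_add, iff_true]
  exact lt_of_lt_of_le (finProdFinEquiv e).2 hW

/-- Additivity of the mass over the `B` parts of an interval of width `B·w`. -/
theorem mass_cellsIn_parts (a b : Fin n × Fin n → ℂ) (c w : ℕ) :
    ∀ B : ℕ, mass a b (cellsIn c (B * w)) = ∑ q ∈ Finset.range B, mass a b (cellsIn (c + q * w) w) := by
  intro B
  induction B with
  | zero =>
    simp only [zero_mul, Finset.range_zero, Finset.sum_empty, mass]
    refine Finset.sum_eq_zero fun e he => ?_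
    simp only [cellsIn, Finset.mem_filter, add_zero] at he
    omega
  | succ B ih =>
    rw [Finset.sum_range_succ, ← ih, show (B + 1) * w = B * w + w by ring, cellsIn_split, mass,
      Finset.sum_union (cellsIn_disjoint _ _ _)]
    rfl

/-- The schedule: blocks of `B` rounds, Alice in the even blocks, Bob in the odd ones. -/
def owner (B : ℕ) (t : ℕ) (_z : Fin t → Bool) : Bool := decide (Even (t / B))

/-- The part of level `i` with index `q`, read off a zero pattern: cells with index in
`[loB i + q·B^(ℓ-1-i), loB i + (q+1)·B^(ℓ-1-i))`. -/
noncomputable def partCells (B ℓ : ℕ) (z : ℕ → Bool) (i q : ℕ) : Finset (Fin n × Fin n) :=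
  cellsIn (loB B ℓ z i + q * B ^ (ℓ - 1 - i)) (B ^ (ℓ - 1 - i))

/-- The messages: in round `t` of block `k = t / B` (level `i = k / 2`, index `q = t % B`), Alice
(`k` even) announces the sum of her entries over part `q` of level `i`; Bob (`k` odd) announces the
message of round `t - B` (Alice's sum over the same part) minus the sum of his entries over it. -/
noncomputable def msg (B ℓ : ℕ) (t : ℕ) (z : Fin t → Bool) : MvPolynomial ((Fin n × Fin n) ⊕ Fin t) ℂ :=
  if Even (t / B) then ∑ e ∈ partCells (n := n) B ℓ (LinSearch.ext z) (t / B / 2) (t % B), X (Sum.inl e)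
  else (if h : B ≤ t ∧ 1 ≤ B then X (Sum.inr ⟨t - B, by omega⟩) else 0) -
    ∑ e ∈ partCells (n := n) B ℓ (LinSearch.ext z) (t / B / 2) (t % B), X (Sum.inl e)

/-- The output: the cell whose index is the left end of the final interval (a default cell if out of
range, which correctness shows never happens). -/
noncomputable def out (B ℓ : ℕ) (hn : 0 < n * n) (z : Fin (2 * B * ℓ) → Bool) : Fin n × Fin n :=
  if h : loB B ℓ (LinSearch.ext z) ℓ < n * n then finProdFinEquiv.symm ⟨loB B ℓ (LinSearch.ext z) ℓ, h⟩
  else finProdFinEquiv.symm ⟨0, hn⟩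

/-- The schedule flips the speaker exactly at the block boundaries: `2ℓ - 1` alternations in `2Bℓ`
rounds along every zero pattern. -/
theorem card_alternations_owner {B : ℕ} (hB : 1 ≤ B) (ℓ : ℕ) (z : ℕ → Bool) :
    ((Finset.range (2 * B * ℓ - 1)).filter (fun s =>
      owner B s (fun j : Fin s => z j) ≠ owner B (s + 1) (fun j : Fin (s + 1) => z j))).card = 2 * ℓ - 1 := by
  have hflip : ∀ s, (owner B s (fun j : Fin s => z j) ≠ owner B (s + 1) (fun j : Fin (s + 1) => z j)) ↔
      B ∣ s + 1 := by
    intro s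
    simp only [owner, ne_eq, decide_eq_decide]
    rw [Nat.succ_div]
    by_cases hd : B ∣ s + 1
    · simp only [hd, if_true, Nat.even_add_one, iff_true]
      exact fun h => iff_not_self h
    · simp [hd]
  rw [Finset.filter_congr (fun s _ => hflip s), Nat.card_multiples]
  rcases Nat.eq_zero_or_pos ℓ with rfl | hℓ
  · simp
  · have h1 : 2 * B * ℓ - 1 = (B - 1) + B * (2 * ℓ - 1) := by
      have : 2 * B * ℓ = B * (2 * ℓ - 1) + B := by
        rw [Nat.mul_sub, mul_one]
        have : B ≤ B * (2 * ℓ) := Nat.le_mul_of_pos_right B (by omega)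
        have h2 : 2 * B * ℓ = B * (2 * ℓ) := by ring
        omega
      omega
    rw [h1, Nat.add_mul_div_left _ _ (by omega), Nat.div_eq_of_lt (by omega), zero_add]

end BlockSearch

open BlockSearch in
/-- **`B`-ary search solves the KW game of a linear form with `2ℓ - 1` alternations in depth `2Bℓ`
whenever `n² ≤ B^ℓ`.**  For `1 ≤ n`, `1 ≤ B` and `n² ≤ B^ℓ` there is a zero-test algebraic protocol of
depth `2Bℓ` in the model of the crux `KWPerLowerBound` whose speaker alternates exactly `2ℓ - 1` times
along every zero pattern and which solves the KW game of `Σ_e x_e`: whenever `Σ_e a_e ≠ Σ_e b_e`, the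
output cell `e` has `a_e ≠ b_e`.  Compare `kwSearch_lowerBound_of_altBound` (no protocol with `Δ`
alternations and depth `T` once `(2T+1)^(Δ+2) + 1 ≤ n²`, for every polynomial depending on every cell,
in particular for this linear form by `linearForm_depends_on_every_cell`). -/
theorem kwSearch_linearForm_blocks (n B ℓ : ℕ) (hn : 1 ≤ n) (hB : 1 ≤ B) (hN : n * n ≤ B ^ ℓ) :
    ∃ (owner : (t : ℕ) → (Fin t → Bool) → Bool)
      (msg : (t : ℕ) → (Fin t → Bool) → MvPolynomial ((Fin n × Fin n) ⊕ Fin t) ℂ)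
      (out : (Fin (2 * B * ℓ) → Bool) → Fin n × Fin n),
      (∀ z : ℕ → Bool, ((Finset.range (2 * B * ℓ - 1)).filter (fun s =>
        owner s (fun j : Fin s => z j) ≠ owner (s + 1) (fun j : Fin (s + 1) => z j))).card = 2 * ℓ - 1) ∧
      ∀ a b : (Fin n × Fin n) → ℂ,
        eval a (∑ e : Fin n × Fin n, X e) ≠ eval b (∑ e : Fin n × Fin n, X e) →
        ∀ (m : ℕ → ℂ) (z : ℕ → Bool), (∀ j, z j = true ↔ m j = 0) →
          (∀ t < 2 * B * ℓ, m t = eval (Sum.elim (if owner t (fun j : Fin t => z j) then a else b)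
            (fun j : Fin t => m j)) (msg t (fun j : Fin t => z j))) →
          a (out (fun j : Fin (2 * B * ℓ) => z j)) ≠ b (out (fun j : Fin (2 * B * ℓ) => z j)) := by
  have hn2 : 0 < n * n := Nat.mul_pos hn hn
  refine ⟨BlockSearch.owner B, BlockSearch.msg B ℓ, BlockSearch.out B ℓ hn2,
    BlockSearch.card_alternations_owner hB ℓ, ?_⟩
  intro a b hab m z hz hm
  have hext : ∀ (t j : ℕ), j < t → LinSearch.ext (fun j : Fin t => z j) j = z j := by
    intro t j hj; simp [LinSearch.ext, hj]
  have hlo : ∀ t i : ℕ, 2 * B * i ≤ t → loB B ℓ (LinSearch.ext (fun j : Fin t => z j)) i = loB B ℓ z i := by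
    intro t i hi
    exact loB_congr B ℓ (fun s hs => hext t s (by omega))
  -- the invariant: the interval of level `i` has nonzero mass
  have key : ∀ i ≤ ℓ, mass a b (cellsIn (loB B ℓ z i) (B ^ (ℓ - i))) ≠ 0 := by
    intro i
    induction i with
    | zero =>
      intro _
      have h0 : loB B ℓ z 0 = 0 := by simp [loB]
      rw [h0, Nat.sub_zero, cellsIn_zero_eq_univ_of_le hN, mass]
      simpa [MvPolynomial.eval_sum, Finset.sum_sub_distrib, sub_ne_zero] using hab
    | succ i ih =>
      intro hi
      have hi' : i < ℓ := hi
      have ihi := ih hi'.le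
      set w := B ^ (ℓ - 1 - i) with hw
      have hBw : B ^ (ℓ - i) = B * w := by
        rw [hw, ← pow_succ']; congr 1; omega
      rw [hBw, mass_cellsIn_parts] at ihi
      -- some part has nonzero mass
      obtain ⟨q, hq, hqne⟩ := Finset.exists_ne_zero_of_sum_ne_zero ihi
      have hqB : q < B := Finset.mem_range.mp hq
      -- the messages of level `i`: for every part `q' < B`
      have hlevel : ∀ q' < B, m (B * (2 * i + 1) + q') = mass a b (cellsIn (loB B ℓ z i + q' * w) w) := by
        intro q' hq'
        have htA : B * (2 * i) + q' < 2 * B * ℓ := by nlinarith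
        have htB : B * (2 * i + 1) + q' < 2 * B * ℓ := by nlinarith
        have hdivA : (B * (2 * i) + q') / B = 2 * i := by
          rw [Nat.add_comm, Nat.add_mul_div_left _ _ (by omega), Nat.div_eq_of_lt hq', zero_add]
        have hdivB : (B * (2 * i + 1) + q') / B = 2 * i + 1 := by
          rw [Nat.add_comm, Nat.add_mul_div_left _ _ (by omega), Nat.div_eq_of_lt hq', zero_add]
        have hmodA : (B * (2 * i) + q') % B = q' := by
          rw [Nat.add_comm, Nat.add_mul_mod_self_left, Nat.mod_eq_of_lt hq']
        have hmodB : (B * (2 * i + 1) + q') % B = q' := by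
          rw [Nat.add_comm, Nat.add_mul_mod_self_left, Nat.mod_eq_of_lt hq']
        have hlvA : 2 * i / 2 = i := by omega
        have hlvB : (2 * i + 1) / 2 = i := by omega
        have hpartA : (partCells B ℓ (LinSearch.ext (fun j : Fin (B * (2 * i) + q') => z j))
            ((B * (2 * i) + q') / B / 2) ((B * (2 * i) + q') % B) : Finset (Fin n × Fin n)) =
            cellsIn (loB B ℓ z i + q' * w) w := by
          simp only [partCells, hdivA, hmodA, hlvA, hw]
          rw [hlo _ i (by nlinarith)]
        have hpartB : (partCells B ℓ (LinSearch.ext (fun j : Fin (B * (2 * i + 1) + q') => z j))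
            ((B * (2 * i + 1) + q') / B / 2) ((B * (2 * i + 1) + q') % B) : Finset (Fin n × Fin n)) =
            cellsIn (loB B ℓ z i + q' * w) w := by
          simp only [partCells, hdivB, hmodB, hlvB, hw]
          rw [hlo _ i (by nlinarith)]
        have hevenA : Even ((B * (2 * i) + q') / B) := by rw [hdivA]; exact even_two_mul i
        have hoddB : ¬ Even ((B * (2 * i + 1) + q') / B) := by rw [hdivB]; exact Nat.not_even_two_mul_add_one i
        -- Alice's message
        have hA := hm _ htA
        have hmsgA : BlockSearch.msg (n := n) B ℓ (B * (2 * i) + q') (fun j : Fin (B * (2 * i) + q') => z j) =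
            ∑ e ∈ cellsIn (loB B ℓ z i + q' * w) w, X (Sum.inl e) := by
          simp only [BlockSearch.msg, if_pos hevenA, hpartA]
        have hownA : BlockSearch.owner B (B * (2 * i) + q') (fun j : Fin (B * (2 * i) + q') => z j) = true := by
          simp [BlockSearch.owner, hevenA]
        have hmA : m (B * (2 * i) + q') = ∑ e ∈ cellsIn (loB B ℓ z i + q' * w) w, a e := by
          rw [hA, hmsgA, hownA, map_sum]
          refine Finset.sum_congr rfl fun e _ => ?_
          simp
        -- Bob's message
        have hB' := hm _ htB
        have hsub : B * (2 * i + 1) + q' - B = B * (2 * i) + q' := by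
          rw [mul_add, mul_one]; omega
        have hcond : B ≤ B * (2 * i + 1) + q' ∧ 1 ≤ B := ⟨by nlinarith, hB⟩
        have hmsgB : BlockSearch.msg (n := n) B ℓ (B * (2 * i + 1) + q')
            (fun j : Fin (B * (2 * i + 1) + q') => z j) =
            X (Sum.inr ⟨B * (2 * i + 1) + q' - B, by omega⟩) -
              ∑ e ∈ cellsIn (loB B ℓ z i + q' * w) w, X (Sum.inl e) := by
          simp only [BlockSearch.msg, if_neg hoddB, hpartB, dif_pos hcond]
        have hownB : BlockSearch.owner B (B * (2 * i + 1) + q')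
            (fun j : Fin (B * (2 * i + 1) + q') => z j) = false := by
          simp [BlockSearch.owner, hoddB]
        rw [hB', hmsgB, hownB, map_sub, map_sum, mass, Finset.sum_sub_distrib]
        congr 1
        · have h1 : (eval (Sum.elim (if false = true then a else b)
              fun j : Fin (B * (2 * i + 1) + q') => m ↑j))
              (X (Sum.inr ⟨B * (2 * i + 1) + q' - B, by omega⟩)) = m (B * (2 * i) + q') := by
            rw [eval_X]; simp [hsub]
          rw [h1, hmA]
        · refine Finset.sum_congr rfl fun e _ => ?_
          simp
      -- the chosen part
      have hex : ∃ q₁, q₁ < B ∧ z (B * (2 * i + 1) + q₁) = false := by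
        refine ⟨q, hqB, ?_⟩
        cases hzq : z (B * (2 * i + 1) + q) with
        | false => rfl
        | true => exact absurd ((hz _).mp hzq) (by rw [hlevel q hqB]; exact hqne)
      have hp := part_spec hex
      have hpB := part_lt hB z i
      have hne : mass a b (cellsIn (loB B ℓ z i + part B z i * w) w) ≠ 0 := by
        rw [← hlevel _ hpB]
        intro h0
        have := (hz _).mpr h0
        rw [hp] at this
        exact Bool.false_ne_true this
      rw [loB_succ]
      have : ℓ - (i + 1) = ℓ - 1 - i := by omega
      rwa [this, ← hw]
  -- at level `ℓ` the interval is a single index, which must be a cell where `a ≠ b`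
  have hL' := key ℓ le_rfl
  rw [Nat.sub_self, pow_zero] at hL'
  obtain ⟨e, he, hne⟩ := Finset.exists_ne_zero_of_sum_ne_zero hL'
  rw [mem_cellsIn_one] at he
  have hidx : loB B ℓ z ℓ < n * n := by rw [← he]; exact (finProdFinEquiv e).2
  have hout : BlockSearch.out B ℓ hn2 (fun j : Fin (2 * B * ℓ) => z j) = e := by
    unfold BlockSearch.out
    rw [hlo (2 * B * ℓ) ℓ le_rfl, dif_pos hidx]
    apply finProdFinEquiv.injective
    rw [Equiv.apply_symm_apply]
    exact Fin.ext he.symm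
  rw [hout]
  exact sub_ne_zero.mp hne

end Summit.ValiantsHypothesis.ValiantsHypothesis.Theorems.AlgebraicKWGames
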